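import Literature.NumberTheory.Automorphic.ResGLnCohomology
import Literature.NumberTheory.Automorphic.ArithmeticQuotientCohomologySemilinear
import Literature.NumberTheory.Automorphic.ClozelAlgebraicityHeckeFieldProofs
import Literature.LinearAlgebra.Semilinear.PiTensorProductSemilinear
import Literature.NumberTheory.DiophantineGeometry.WeylModuleSemilinear
import HarnessLib

/-!
# Clozel's Hecke-field theorem over a general number field: reduction to the cohomology of
# `Res_{K/ℚ} GL_n` (proofs)

Proofs-only companion (theorems only: no definition, no named fact, no instance) of
`ClozelAlgebraicity.lean` for the named fact `Clozel1990_heckeEigenvalueField` (Clozel 1990,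
Thm. 3.13 in Hecke-eigenvalue form: for `π` cuspidal regular algebraic on `GL_n(𝔸_K)`, `K` ANY
number field, the unramified Hecke eigenvalues `t_{v,i}` at all but finitely many `v` lie in one
number field), on the general-`K` receptacle `ResGLnCohomology.levelCohomology`
(`ResGLnCohomology.lean`: `H^q(S_{K_f(𝔫)}, Ẽ_λ) = H^q(GL_n(K)⁺, Fun(GL_n(𝔸_K^∞)/K_f(𝔫), E_λ(ℂ)))`,
`E_λ = ⊗_{τ : K →+* ℂ} V_{λ_τ}`, with its Hecke operators `heckeT … v i = T_{v,i}`).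

Clozel's proof (§3.5, pp. 122–123; Grobner–Raghuram 2014, §7.2–§7.3 and Thm. 50): (1)–(2) a
cuspidal regular algebraic `π` has cohomological `π_∞` (Lemme 3.14) and `π_f^{K_f}` occurs
Hecke-equivariantly in the finite-dimensional `H^•(S_{K_f}, Ẽ_λ)` (Lemme 3.15, Borel); (3) this
cohomology has a `ℚ(λ)`-structure preserved by the Hecke operators, equivalently `Aut(ℂ/ℚ(λ))`
acts on it `σ`-semilinearly commuting with the `T_{v,i}` (`σ^*`, p. 122); (4) hence the
eigensystem has finitely many `Aut(ℂ/ℚ(λ))`-conjugates and its field of rationality is a number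
field. Step (4) is the tree's `heckeEigenvalue_mem_subfield_cofinite_of_semilinearAction`
(`ClozelAlgebraicityHeckeFieldProofs.lean`). THIS FILE proves step (3) on the tree's carrier for
every number field `K` and assembles:

* `ResGLnCohomology.map_map_eq_of_forall_apply_eq` — `σ(τ(g)) = τ(g)` entrywise when `σ` fixes
  `τ(K)`;
* `ResGLnCohomology.coeffSemimap_coeffRep` — for `σ : ℂ →+* ℂ` fixing every `τ(K)` and a family
  of `σ`-semilinear maps `s_τ` of the factors `V_{λ_τ}(ℂ)` intertwining `V_{λ_τ}(g)` and
  `V_{λ_τ}(σ g)` (`g ∈ GL_n(ℂ)`), the `σ`-semilinear `⊗_τ s_τ` of `E_λ(ℂ)`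
  (`Literature.LinearAlgebra.Semilinear.PiTensorProduct.semimap`) commutes with `GL_n(K)`;
  `coeffSemimap_leftInverse` — factorwise left inverses give a left inverse;
* `ResGLnCohomology.finiteDimensional_embCompositum`, `apply_eq_of_mem_fixingSubgroup_embCompositum`
  — the compositum `K̃ = ⨆_τ τ(K) ⊆ ℂ` is finite over `ℚ` and `Aut(ℂ/K̃)` fixes every `τ(K)`
  pointwise (so for `σ ∈ Aut(ℂ/K̃)` no permutation of the tensor factors is needed; `K̃ ⊇ ℚ(λ)` is
  a cruder but sufficient field of definition);
* `Clozel1990_heckeEigenvalueField_of_resRealisation_of_coeffSemimaps` — **the named fact from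
  (1)–(2) and finite-dimensionality as explicit hypotheses on `ResGLnCohomology.levelCohomology ℂ`,
  given the `σ`-semilinear symmetries of the factors `V_μ(ℂ) = GLnCohomology.CoeffModule ℂ n μ`**
  (for every `σ ∈ Aut(ℂ)` and weight `μ`, a `σ`-semilinear self-map of `V_μ(ℂ)` intertwining
  `V_μ(g)` and `V_μ(σ g)` with a `σ⁻¹`-semilinear equivariant left inverse — in print `1 ⊗ σ` on
  `V_μ(ℚ) ⊗ ℂ`; on the tree's Weyl-module model the coordinatewise action of `σ` on `c_μ(ℂⁿ)^{⊗d}`,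
  `Literature/NumberTheory/DiophantineGeometry/WeylModuleSemilinear.lean`). Assembly: the symmetry
  `θ_σ = H^q(⊗_τ s_τ)` (`TwistedQuotient.cohomologySemimap`, file
  `ArithmeticQuotientCohomologySemilinear.lean`) is `σ`-semilinear, commutes with every
  `[K_f(𝔫) g K_f(𝔫)]` (`cohomologySemimap_heckeEnd`) and is injective
  (`cohomologySemimap_injective_of_leftInverse`); with the eigenclass of (1)–(2), the finite
  exceptional set `{v ∣ 𝔫}` and `E = K̃`, step (4) concludes. (`n = 0`:
  `Clozel1990_heckeEigenvalueField.rank_zero`.)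
* `GLnCohomology.weylSemimap_coeffRepGL`, `GLnCohomology.exists_coeffSemimap` — those factor
  symmetries EXIST on the tree's model `V_μ(k) = S_{μ−μ_{n−1}}(kⁿ) ⊗ det^{μ_{n−1}}`: the tree's
  `weylSemimap φ` (`WeylModuleSemilinear.lean`, `φ` on the coordinates of `c_μ(kⁿ)^{⊗d}`,
  `weylSemimap_weylRep`) together with `φ(det g) = det(φ g)` for the twist;
* `Clozel1990_heckeEigenvalueField_of_resRealisation` — **the named fact from the two remaining
  published inputs alone**: the realisation `hE` and the finite-dimensionality `hB`.

Nothing is asserted: the realisation (Clozel Lemme 3.14–3.15 with Borel's injectivity of cuspidal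
into full cohomology) and the finite-dimensionality (Borel–Serre, through Shapiro's lemma and the
finiteness of `GL_n(K)⁺\GL_n(𝔸_K^∞)/K_f(𝔫)`) are published theorems taken as hypotheses, so the
theorem records exactly what separates the fact from the tree for general `K` (for `K = ℚ` compare
`Clozel1990_heckeEigenvalueField.rat_of_cuspidalEigenclass_exists`,
`ClozelAlgebraicityHeckeFieldRatProofs.lean`).

## References

* L. Clozel, *Motifs et formes automorphes: applications du principe de fonctorialité*, in:
  Automorphic forms, Shimura varieties, and L-functions I (Ann Arbor 1988), Perspect. Math. 10,
  Academic Press 1990: Thm. 3.13, Lemme 3.14–3.15, §3.5 (pp. 122–123). [Clozel1990]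
* H. Grobner, A. Raghuram, *On some arithmetic properties of automorphic forms of GL_m over a
  division algebra*, Int. J. Number Theory 10 (2014) = arXiv:1102.1872, §7.2 (σ^* on
  `H^q(S_{G'}, ℰ_μ)`), Prop. 45, Thm. 50. [GrobnerRaghuram2014]
-/

noncomputable section

open scoped TensorProduct
open NumberField IsDedekindDomain IntermediateField

namespace Literature.NumberTheory.Automorphic

namespace ResGLnCohomology

open GLnCohomology Literature.LinearAlgebra.Semilinear

/-! ### `σ` fixing `τ(K)`: no twist of the `GL_n(K)`-action -/

section Fix

variable {n : ℕ} {K : Type} [Field K]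

/-- If `σ : ℂ → ℂ` fixes `τ(K)` pointwise then `σ(τ(g)) = τ(g)` for `g ∈ GL_n(K)` (entrywise).
[folklore] -/
theorem map_map_eq_of_forall_apply_eq {σ : ℂ →+* ℂ} {τ : K →+* ℂ} (h : ∀ x : K, σ (τ x) = τ x)
    (g : GL (Fin n) K) :
    Matrix.GeneralLinearGroup.map σ (Matrix.GeneralLinearGroup.map τ g) =
      Matrix.GeneralLinearGroup.map τ g := by
  ext i j
  rw [Matrix.GeneralLinearGroup.map_apply, Matrix.GeneralLinearGroup.map_apply]
  exact h _

end Fix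

/-! ### The `σ`-semilinear symmetry `⊗_τ s_τ` of `E_λ(ℂ)` -/

section CoeffSemimap

variable {n : ℕ} {K : Type} [Field K] {lam : (K →+* ℂ) → Fin n → ℤ}

/-- **`⊗_τ s_τ` commutes with `GL_n(K)` on `E_λ(ℂ)`.** Let `σ : ℂ → ℂ` be a ring homomorphism
fixing `τ(K)` pointwise for every embedding `τ : K →+* ℂ`, and `s_τ : V_{λ_τ}(ℂ) → V_{λ_τ}(ℂ)`
`σ`-semilinear maps intertwining `V_{λ_τ}(g)` and `V_{λ_τ}(σ g)` for all `g ∈ GL_n(ℂ)` (in print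
`s_τ = 1 ⊗ σ` on `V_{λ_τ}(ℚ) ⊗ ℂ`). Then the `σ`-semilinear map `⊗_τ s_τ` of
`E_λ(ℂ) = ⊗_τ V_{λ_τ}(ℂ)` (`PiTensorProduct.semimap`) commutes with the action `coeffRep` of
`GL_n(K)` (`g ↦ ⊗_τ V_{λ_τ}(τ g)`, and `σ(τ g) = τ g`). [cite: Clozel1990, §3.5 (p. 122, σ^*)]
[cite: GrobnerRaghuram2014, §7.2] -/
theorem coeffSemimap_coeffRep {σ : ℂ →+* ℂ} (hσ : ∀ (τ : K →+* ℂ) (x : K), σ (τ x) = τ x)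
    (s : ∀ τ : K →+* ℂ,
      GLnCohomology.CoeffModule ℂ n (lam τ) →ₛₗ[σ] GLnCohomology.CoeffModule ℂ n (lam τ))
    (hs : ∀ (τ : K →+* ℂ) (g : GL (Fin n) ℂ) (w : GLnCohomology.CoeffModule ℂ n (lam τ)),
      s τ (coeffRepGL ℂ n (lam τ) g w) =
        coeffRepGL ℂ n (lam τ) (Matrix.GeneralLinearGroup.map σ g) (s τ w))
    (g : GL (Fin n) K) (v : ResGLnCohomology.CoeffModule ℂ n K lam) :
    (PiTensorProduct.semimap s :
        ResGLnCohomology.CoeffModule ℂ n K lam →ₛₗ[σ] ResGLnCohomology.CoeffModule ℂ n K lam)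
      (coeffRep ℂ n K lam g v) =
      coeffRep ℂ n K lam g
        ((PiTensorProduct.semimap s :
          ResGLnCohomology.CoeffModule ℂ n K lam →ₛₗ[σ] ResGLnCohomology.CoeffModule ℂ n K lam) v) := by
  rw [coeffRep_apply]
  refine PiTensorProduct.semimap_map s s _ _ (fun τ w => ?_) v
  rw [hs τ, map_map_eq_of_forall_apply_eq (hσ τ) g]

/-- `⊗_τ s_τ` on `GL_n(K)⁺` (`coeffRepPos`): the hypothesis `hs₀` of
`TwistedQuotient.cohomologySemimap`. [folklore] -/
theorem coeffSemimap_coeffRepPos {σ : ℂ →+* ℂ} (hσ : ∀ (τ : K →+* ℂ) (x : K), σ (τ x) = τ x)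
    (s : ∀ τ : K →+* ℂ,
      GLnCohomology.CoeffModule ℂ n (lam τ) →ₛₗ[σ] GLnCohomology.CoeffModule ℂ n (lam τ))
    (hs : ∀ (τ : K →+* ℂ) (g : GL (Fin n) ℂ) (w : GLnCohomology.CoeffModule ℂ n (lam τ)),
      s τ (coeffRepGL ℂ n (lam τ) g w) =
        coeffRepGL ℂ n (lam τ) (Matrix.GeneralLinearGroup.map σ g) (s τ w))
    (γ : glTotPos n K) (v : ResGLnCohomology.CoeffModule ℂ n K lam) :
    (PiTensorProduct.semimap s :
        ResGLnCohomology.CoeffModule ℂ n K lam →ₛₗ[σ] ResGLnCohomology.CoeffModule ℂ n K lam)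
      (coeffRepPos ℂ n K lam γ v) =
      coeffRepPos ℂ n K lam γ
        ((PiTensorProduct.semimap s :
          ResGLnCohomology.CoeffModule ℂ n K lam →ₛₗ[σ] ResGLnCohomology.CoeffModule ℂ n K lam) v) :=
  coeffSemimap_coeffRep hσ s hs (γ : GL (Fin n) K) v

/-- **Left inverse**: if `s'_τ ∘ s_τ = id` factorwise (`σ' ∘ σ = id`), then
`(⊗_τ s'_τ) ∘ (⊗_τ s_τ) = id` on `E_λ(ℂ)`. [folklore] -/
theorem coeffSemimap_leftInverse {σ σ' : ℂ →+* ℂ} (hσσ' : ∀ c : ℂ, σ' (σ c) = c)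
    (s : ∀ τ : K →+* ℂ,
      GLnCohomology.CoeffModule ℂ n (lam τ) →ₛₗ[σ] GLnCohomology.CoeffModule ℂ n (lam τ))
    (s' : ∀ τ : K →+* ℂ,
      GLnCohomology.CoeffModule ℂ n (lam τ) →ₛₗ[σ'] GLnCohomology.CoeffModule ℂ n (lam τ))
    (h : ∀ (τ : K →+* ℂ) (w : GLnCohomology.CoeffModule ℂ n (lam τ)), s' τ (s τ w) = w)
    (v : ResGLnCohomology.CoeffModule ℂ n K lam) :
    (PiTensorProduct.semimap s' :
        ResGLnCohomology.CoeffModule ℂ n K lam →ₛₗ[σ'] ResGLnCohomology.CoeffModule ℂ n K lam)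
      ((PiTensorProduct.semimap s :
        ResGLnCohomology.CoeffModule ℂ n K lam →ₛₗ[σ] ResGLnCohomology.CoeffModule ℂ n K lam) v) = v :=
  PiTensorProduct.semimap_semimap_of_leftInverse s s' hσσ' h v

end CoeffSemimap

/-! ### The compositum `K̃ = ⨆_τ τ(K)` of the embeddings of `K` -/

section Compositum

variable (K : Type) [Field K] [NumberField K]

/-- The compositum `K̃ = ⨆_{τ : K →+* ℂ} τ(K) ⊆ ℂ` (the Galois closure of `K` in `ℂ`) is finite
over `ℚ`: finitely many embeddings (`NumberField.Embeddings`), each with image `≅ K`.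
[folklore] -/
theorem finiteDimensional_embCompositum :
    FiniteDimensional ℚ
      (⨆ τ : K →+* ℂ, (τ.toRatAlgHom).fieldRange : IntermediateField ℚ ℂ) := by
  haveI : ∀ τ : K →+* ℂ, FiniteDimensional ℚ (τ.toRatAlgHom).fieldRange := fun τ =>
    LinearEquiv.finiteDimensional (τ.toRatAlgHom.equivFieldRange).toLinearEquiv
  exact IntermediateField.finiteDimensional_iSup_of_finite

variable {K} in
/-- An automorphism of `ℂ` fixing the compositum `K̃` fixes every `τ(K)` pointwise:
`σ(τ x) = τ x`. [folklore] -/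
theorem apply_eq_of_mem_fixingSubgroup_embCompositum {σ : ℂ ≃ₐ[ℚ] ℂ}
    (hσ : σ ∈ (⨆ τ : K →+* ℂ, (τ.toRatAlgHom).fieldRange : IntermediateField ℚ ℂ).fixingSubgroup)
    (τ : K →+* ℂ) (x : K) : σ (τ x) = τ x := by
  rw [IntermediateField.mem_fixingSubgroup_iff] at hσ
  refine hσ (τ x) ?_
  have hle : (τ.toRatAlgHom).fieldRange ≤
      (⨆ τ : K →+* ℂ, (τ.toRatAlgHom).fieldRange : IntermediateField ℚ ℂ) :=
    le_iSup (fun τ : K →+* ℂ => (τ.toRatAlgHom).fieldRange) τ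
  exact hle (AlgHom.mem_fieldRange.mpr ⟨x, rfl⟩)

end Compositum

end ResGLnCohomology

/-! ### The `σ`-conjugation of the factors `V_μ(ℂ)` (Weyl module with `det` twist) -/

namespace GLnCohomology

open Literature.NumberTheory.DiophantineGeometry

/-- **The `φ`-semilinear conjugation of `V_μ` intertwines `V_μ(g)` and `V_μ(φ g)`.** For a field
homomorphism `φ : k → k'`, the tree's `weylSemimap φ` (`WeylModuleSemilinear.lean`: `φ` applied to
the coordinates of `c_μ · (kⁿ)^{⊗d}`), viewed on `V_μ(k) = GLnCohomology.CoeffModule k n μ`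
(`= S_{μ−μ_{n−1}}(kⁿ) ⊗ det^{μ_{n−1}}`), satisfies `φ̃ (V_μ(g) w) = V_μ(φ g) (φ̃ w)` for
`g ∈ GL_n(k)`: `weylSemimap_weylRep` for the Weyl factor and `φ(det g) = det(φ g)` for the twist.
(For `φ = σ ∈ Aut(ℂ)`: `V_μ(ℂ) = V_μ(ℚ) ⊗ ℂ` with `σ` acting on the second factor commutes with
`GL_n(ℚ)`, and twists `GL_n(ℂ)` through `σ`; Clozel 1990, p. 122.)
[cite: Clozel1990, §3.5 (p. 122)] [cite: FultonHarrisGTM129, §15.5 and §6.1 Thm. 6.3] -/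
theorem weylSemimap_coeffRepGL {k k' : Type} [Field k] [Field k'] (φ : k →+* k') (n : ℕ)
    (μ : Fin n → ℤ) (g : GL (Fin n) k) (w : GLnCohomology.CoeffModule k n μ) :
    (weylSemimap φ (Fin n) (coeffPartition μ) :
        GLnCohomology.CoeffModule k n μ →ₛₗ[φ] GLnCohomology.CoeffModule k' n μ)
      (coeffRepGL k n μ g w) =
      coeffRepGL k' n μ (Matrix.GeneralLinearGroup.map φ g)
        ((weylSemimap φ (Fin n) (coeffPartition μ) :
          GLnCohomology.CoeffModule k n μ →ₛₗ[φ] GLnCohomology.CoeffModule k' n μ) w) := by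
  -- computed on the underlying Weyl module `S_μ(kⁿ)` (of which `V_μ(k)` is a synonym)
  show weylSemimap φ (Fin n) (coeffPartition μ)
      (((Matrix.GeneralLinearGroup.det g ^ lowestEntry μ : kˣ) : k) •
        weylRep k (Fin n) (coeffPartition μ) g w) =
    ((Matrix.GeneralLinearGroup.det (Matrix.GeneralLinearGroup.map φ g) ^ lowestEntry μ : k'ˣ) : k') •
      weylRep k' (Fin n) (coeffPartition μ) (Matrix.GeneralLinearGroup.map φ g)
        (weylSemimap φ (Fin n) (coeffPartition μ) w)
  rw [map_smulₛₗ, weylSemimap_weylRep]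
  congr 1
  rw [Matrix.GeneralLinearGroup.map_det]
  simp only [Units.val_zpow_eq_zpow_val, map_zpow₀, Units.coe_map, MonoidHom.coe_coe]

/-- Left inverse: `ψ̃ ∘ φ̃ = id` on `V_μ` when `ψ ∘ φ = id` (`weylSemimap_weylSemimap_of_leftInverse`).
[folklore] -/
theorem weylSemimap_weylSemimap_coeffModule {k k' : Type} [Field k] [Field k'] (φ : k →+* k')
    (ψ : k' →+* k) (h : ∀ c, ψ (φ c) = c) (n : ℕ) (μ : Fin n → ℤ)
    (w : GLnCohomology.CoeffModule k n μ) :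
    (weylSemimap ψ (Fin n) (coeffPartition μ) :
        GLnCohomology.CoeffModule k' n μ →ₛₗ[ψ] GLnCohomology.CoeffModule k n μ)
      ((weylSemimap φ (Fin n) (coeffPartition μ) :
        GLnCohomology.CoeffModule k n μ →ₛₗ[φ] GLnCohomology.CoeffModule k' n μ) w) = w :=
  weylSemimap_weylSemimap_of_leftInverse φ (Fin n) ψ h (coeffPartition μ) w

/-- **The `Aut(ℂ)`-symmetries of `V_μ(ℂ)`** in the shape consumed by
`Clozel1990_heckeEigenvalueField_of_resRealisation_of_coeffSemimaps`: for `σ ∈ Aut(ℂ)` the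
`σ`-conjugation `s = σ̃` and `s' = (σ⁻¹)̃` of `V_μ(ℂ)`, equivariant along `g ↦ σ g`, `σ⁻¹ g`, with
`s' ∘ s = id`. [cite: Clozel1990, §3.5 (p. 122)] -/
theorem exists_coeffSemimap (n : ℕ) (σ : ℂ ≃ₐ[ℚ] ℂ) (μ : Fin n → ℤ) :
    ∃ (s : GLnCohomology.CoeffModule ℂ n μ →ₛₗ[((σ : ℂ ≃ₐ[ℚ] ℂ) : ℂ →+* ℂ)]
        GLnCohomology.CoeffModule ℂ n μ)
      (s' : GLnCohomology.CoeffModule ℂ n μ →ₛₗ[((σ.symm : ℂ ≃ₐ[ℚ] ℂ) : ℂ →+* ℂ)]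
        GLnCohomology.CoeffModule ℂ n μ),
      (∀ (g : GL (Fin n) ℂ) (w : GLnCohomology.CoeffModule ℂ n μ),
        s (coeffRepGL ℂ n μ g w) =
          coeffRepGL ℂ n μ (Matrix.GeneralLinearGroup.map ((σ : ℂ ≃ₐ[ℚ] ℂ) : ℂ →+* ℂ) g) (s w)) ∧
      (∀ (g : GL (Fin n) ℂ) (w : GLnCohomology.CoeffModule ℂ n μ),
        s' (coeffRepGL ℂ n μ g w) =
          coeffRepGL ℂ n μ
            (Matrix.GeneralLinearGroup.map ((σ.symm : ℂ ≃ₐ[ℚ] ℂ) : ℂ →+* ℂ) g) (s' w)) ∧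
      ∀ w, s' (s w) = w :=
  ⟨(weylSemimap ((σ : ℂ ≃ₐ[ℚ] ℂ) : ℂ →+* ℂ) (Fin n) (coeffPartition μ) :
      GLnCohomology.CoeffModule ℂ n μ →ₛₗ[((σ : ℂ ≃ₐ[ℚ] ℂ) : ℂ →+* ℂ)]
        GLnCohomology.CoeffModule ℂ n μ),
    (weylSemimap ((σ.symm : ℂ ≃ₐ[ℚ] ℂ) : ℂ →+* ℂ) (Fin n) (coeffPartition μ) :
      GLnCohomology.CoeffModule ℂ n μ →ₛₗ[((σ.symm : ℂ ≃ₐ[ℚ] ℂ) : ℂ →+* ℂ)]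
        GLnCohomology.CoeffModule ℂ n μ),
    fun g w => weylSemimap_coeffRepGL _ n μ g w, fun g w => weylSemimap_coeffRepGL _ n μ g w,
    fun w => weylSemimap_weylSemimap_coeffModule _ _ (fun c => σ.symm_apply_apply c) n μ w⟩

end GLnCohomology

/-! ### The named fact from the realisation over `K`, finite-dimensionality, and the factor symmetries -/

/-- **`Clozel1990_heckeEigenvalueField` from steps (1)–(2) of Clozel's proof on the receptacle
`ResGLnCohomology.levelCohomology`, its finite-dimensionality, and the `Aut(ℂ)`-symmetries of the
factors `V_μ(ℂ)`.** Assume: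
* `hS` — for every `n`, `σ ∈ Aut(ℂ)` and `μ : Fin n → ℤ`, a `σ`-semilinear `s : V_μ(ℂ) → V_μ(ℂ)`
  (`V_μ = GLnCohomology.CoeffModule`) with `s ∘ V_μ(g) = V_μ(σ g) ∘ s` for `g ∈ GL_n(ℂ)` and a
  `σ⁻¹`-semilinear `s'` with the same property for `σ⁻¹` and `s' ∘ s = id` (the rational structure
  `V_μ(ℂ) = V_μ(ℚ) ⊗ ℂ` in semilinear form; Clozel p. 122, Grobner–Raghuram Lemma 37);
* `hE` — REALISATION: for `n ≥ 1` and every cuspidal regular algebraic `π` on `GL_n(𝔸_K)` there are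
  an ideal `𝔫 ≠ 0`, a weight `λ`, a degree `q` and a non-zero `x ∈ H^q(S_{K_f(𝔫)}, Ẽ_λ)`
  (`levelCohomology ℂ n K 𝔫 λ q`) with `T_{v,i} x = t_{v,i}(π) x` for all `v ∤ 𝔫` at which `π`
  has Satake parameter `α` (`t_{v,i} = heckeEigenvalueOf n v α i`) and all `i ≤ n` (Clozel, Lemme
  3.14–3.15 and §3.5: `π_f^{K_f} ⊗ H^q(𝔤, K_∞; π_∞ ⊗ E_λ) ↪ H^q_cusp ⊆ H^q(S_{K_f}, Ẽ_λ)`, Borel;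
  the eigenvalue of the double coset `T_{v,i}` on the spherical vector);
* `hB` — FINITENESS: `H^q(S_{K_f(𝔫)}, Ẽ_λ)` is finite-dimensional for `𝔫 ≠ 0` (Borel–Serre).
Then `Clozel1990_heckeEigenvalueField` holds: with `K̃ = ⨆_τ τ(K)` (finite over `ℚ`), every
`σ ∈ Aut(ℂ/K̃)` fixes each `τ(K)`, so `θ_σ = H^q(⊗_τ s_{σ,λ_τ})` (`TwistedQuotient.cohomologySemimap`)
is an injective `σ`-semilinear map of `H^q(S_{K_f(𝔫)}, Ẽ_λ)` commuting with all `T_{v,i}`, and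
`heckeEigenvalue_mem_subfield_cofinite_of_semilinearAction` (step (4)) applies with the finite
exceptional set `{v ∣ 𝔫}`. [cite: Clozel1990, Thm. 3.13 (proof, §3.5 pp. 122–123)]
[cite: GrobnerRaghuram2014, §7.2 and Thm. 50 (arXiv:1102.1872 numbering)] -/
theorem Clozel1990_heckeEigenvalueField_of_resRealisation_of_coeffSemimaps
    (hS : ∀ (n : ℕ) (σ : ℂ ≃ₐ[ℚ] ℂ) (μ : Fin n → ℤ),
      ∃ (s : GLnCohomology.CoeffModule ℂ n μ →ₛₗ[((σ : ℂ ≃ₐ[ℚ] ℂ) : ℂ →+* ℂ)]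
          GLnCohomology.CoeffModule ℂ n μ)
        (s' : GLnCohomology.CoeffModule ℂ n μ →ₛₗ[((σ.symm : ℂ ≃ₐ[ℚ] ℂ) : ℂ →+* ℂ)]
          GLnCohomology.CoeffModule ℂ n μ),
        (∀ (g : GL (Fin n) ℂ) (w : GLnCohomology.CoeffModule ℂ n μ),
          s (GLnCohomology.coeffRepGL ℂ n μ g w) =
            GLnCohomology.coeffRepGL ℂ n μ
              (Matrix.GeneralLinearGroup.map ((σ : ℂ ≃ₐ[ℚ] ℂ) : ℂ →+* ℂ) g) (s w)) ∧
        (∀ (g : GL (Fin n) ℂ) (w : GLnCohomology.CoeffModule ℂ n μ),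
          s' (GLnCohomology.coeffRepGL ℂ n μ g w) =
            GLnCohomology.coeffRepGL ℂ n μ
              (Matrix.GeneralLinearGroup.map ((σ.symm : ℂ ≃ₐ[ℚ] ℂ) : ℂ →+* ℂ) g) (s' w)) ∧
        ∀ w, s' (s w) = w)
    (hE : ∀ (n : ℕ) (K : Type) [Field K] [NumberField K]
      (hcpt : isCompact_glFiniteIntegralLevel n K) (π : CuspidalAutomorphicRepData n K hcpt),
      1 ≤ n → π.1.IsRegularAlgebraic →
      ∃ (𝔫 : Ideal (𝓞 K)) (_ : 𝔫 ≠ 0) (lam : (K →+* ℂ) → Fin n → ℤ) (q : ℕ)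
        (x : ResGLnCohomology.levelCohomology ℂ n K 𝔫 lam q), x ≠ 0 ∧
        ∀ v : HeightOneSpectrum (𝓞 K), ¬ v.asIdeal ∣ 𝔫 → ∀ α : Multiset ℂ,
          π.1.HasSatakeParamAt v α → ∀ i ≤ n,
            ResGLnCohomology.heckeT ℂ n K 𝔫 lam q v i x = heckeEigenvalueOf n v α i • x)
    (hB : ∀ (n : ℕ) (K : Type) [Field K] [NumberField K] (𝔫 : Ideal (𝓞 K)),
      𝔫 ≠ 0 → ∀ (lam : (K →+* ℂ) → Fin n → ℤ) (q : ℕ),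
        FiniteDimensional ℂ (ResGLnCohomology.levelCohomology ℂ n K 𝔫 lam q)) :
    Clozel1990_heckeEigenvalueField := by
  intro n K _ _ hcpt π hπ
  -- `n = 0` is the degenerate slice
  rcases Nat.eq_zero_or_pos n with rfl | hn
  · exact Clozel1990_heckeEigenvalueField.rank_zero K hcpt π
  -- (1)–(2): the eigenclass in `H^q(S_{K_f(𝔫)}, Ẽ_λ)`
  obtain ⟨𝔫, h𝔫, lam, q, x, hx, heig⟩ := hE n K hcpt π hn hπ
  haveI : FiniteDimensional ℂ (ResGLnCohomology.levelCohomology ℂ n K 𝔫 lam q) := hB n K 𝔫 h𝔫 lam q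
  -- the number field `K̃`
  set E : IntermediateField ℚ ℂ :=
    (⨆ τ : K →+* ℂ, (τ.toRatAlgHom).fieldRange : IntermediateField ℚ ℂ) with hEdef
  haveI : FiniteDimensional ℚ E := ResGLnCohomology.finiteDimensional_embCompositum K
  -- (3): the symmetries `θ_σ`, `σ ∈ Aut(ℂ/K̃)`
  have hfix : ∀ σ : E.fixingSubgroup, ∀ (τ : K →+* ℂ) (y : K),
      ((σ : ℂ ≃ₐ[ℚ] ℂ) : ℂ →+* ℂ) (τ y) = τ y :=
    fun σ τ y => ResGLnCohomology.apply_eq_of_mem_fixingSubgroup_embCompositum σ.2 τ y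
  -- factor data for `σ` and the weights `λ_τ`
  let s : ∀ σ : E.fixingSubgroup, ∀ τ : K →+* ℂ,
      GLnCohomology.CoeffModule ℂ n (lam τ) →ₛₗ[((σ : ℂ ≃ₐ[ℚ] ℂ) : ℂ →+* ℂ)]
        GLnCohomology.CoeffModule ℂ n (lam τ) :=
    fun σ τ => (hS n (σ : ℂ ≃ₐ[ℚ] ℂ) (lam τ)).choose
  let s' : ∀ σ : E.fixingSubgroup, ∀ τ : K →+* ℂ,
      GLnCohomology.CoeffModule ℂ n (lam τ) →ₛₗ[(((σ : ℂ ≃ₐ[ℚ] ℂ).symm : ℂ ≃ₐ[ℚ] ℂ) : ℂ →+* ℂ)]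
        GLnCohomology.CoeffModule ℂ n (lam τ) :=
    fun σ τ => (hS n (σ : ℂ ≃ₐ[ℚ] ℂ) (lam τ)).choose_spec.choose
  have hs : ∀ (σ : E.fixingSubgroup) (τ : K →+* ℂ) (g : GL (Fin n) ℂ)
      (w : GLnCohomology.CoeffModule ℂ n (lam τ)),
      s σ τ (GLnCohomology.coeffRepGL ℂ n (lam τ) g w) =
        GLnCohomology.coeffRepGL ℂ n (lam τ)
          (Matrix.GeneralLinearGroup.map ((σ : ℂ ≃ₐ[ℚ] ℂ) : ℂ →+* ℂ) g) (s σ τ w) :=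
    fun σ τ => (hS n (σ : ℂ ≃ₐ[ℚ] ℂ) (lam τ)).choose_spec.choose_spec.1
  have hs' : ∀ (σ : E.fixingSubgroup) (τ : K →+* ℂ) (g : GL (Fin n) ℂ)
      (w : GLnCohomology.CoeffModule ℂ n (lam τ)),
      s' σ τ (GLnCohomology.coeffRepGL ℂ n (lam τ) g w) =
        GLnCohomology.coeffRepGL ℂ n (lam τ)
          (Matrix.GeneralLinearGroup.map (((σ : ℂ ≃ₐ[ℚ] ℂ).symm : ℂ ≃ₐ[ℚ] ℂ) : ℂ →+* ℂ) g)
          (s' σ τ w) :=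
    fun σ τ => (hS n (σ : ℂ ≃ₐ[ℚ] ℂ) (lam τ)).choose_spec.choose_spec.2.1
  have hss' : ∀ (σ : E.fixingSubgroup) (τ : K →+* ℂ) (w : GLnCohomology.CoeffModule ℂ n (lam τ)),
      s' σ τ (s σ τ w) = w :=
    fun σ τ => (hS n (σ : ℂ ≃ₐ[ℚ] ℂ) (lam τ)).choose_spec.choose_spec.2.2
  -- `σ⁻¹` also fixes every `τ(K)`
  have hfix' : ∀ σ : E.fixingSubgroup, ∀ (τ : K →+* ℂ) (y : K),
      (((σ : ℂ ≃ₐ[ℚ] ℂ).symm : ℂ ≃ₐ[ℚ] ℂ) : ℂ →+* ℂ) (τ y) = τ y := by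
    intro σ τ y
    have h1 : (σ : ℂ ≃ₐ[ℚ] ℂ) (τ y) = τ y := hfix σ τ y
    show (σ : ℂ ≃ₐ[ℚ] ℂ).symm (τ y) = τ y
    conv_lhs => rw [← h1]
    exact (σ : ℂ ≃ₐ[ℚ] ℂ).symm_apply_apply (τ y)
  -- the coefficient symmetries `⊗_τ s_τ`, `⊗_τ s'_τ` and their equivariance
  let S₀ : ∀ σ : E.fixingSubgroup,
      ResGLnCohomology.CoeffModule ℂ n K lam →ₛₗ[((σ : ℂ ≃ₐ[ℚ] ℂ) : ℂ →+* ℂ)]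
        ResGLnCohomology.CoeffModule ℂ n K lam :=
    fun σ => Literature.LinearAlgebra.Semilinear.PiTensorProduct.semimap (s σ)
  let S₀' : ∀ σ : E.fixingSubgroup,
      ResGLnCohomology.CoeffModule ℂ n K lam →ₛₗ[(((σ : ℂ ≃ₐ[ℚ] ℂ).symm : ℂ ≃ₐ[ℚ] ℂ) : ℂ →+* ℂ)]
        ResGLnCohomology.CoeffModule ℂ n K lam :=
    fun σ => Literature.LinearAlgebra.Semilinear.PiTensorProduct.semimap (s' σ)
  have hS₀ : ∀ (σ : E.fixingSubgroup) (γ : ResGLnCohomology.glTotPos n K) (v : ResGLnCohomology.CoeffModule ℂ n K lam),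
      S₀ σ (ResGLnCohomology.coeffRepPos ℂ n K lam γ v) = ResGLnCohomology.coeffRepPos ℂ n K lam γ (S₀ σ v) :=
    fun σ γ v => ResGLnCohomology.coeffSemimap_coeffRepPos (hfix σ) (s σ) (hs σ) γ v
  have hS₀' : ∀ (σ : E.fixingSubgroup) (γ : ResGLnCohomology.glTotPos n K) (v : ResGLnCohomology.CoeffModule ℂ n K lam),
      S₀' σ (ResGLnCohomology.coeffRepPos ℂ n K lam γ v) = ResGLnCohomology.coeffRepPos ℂ n K lam γ (S₀' σ v) :=
    fun σ γ v => ResGLnCohomology.coeffSemimap_coeffRepPos (hfix' σ) (s' σ) (hs' σ) γ v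
  have hσσ' : ∀ (σ : E.fixingSubgroup) (c : ℂ),
      (((σ : ℂ ≃ₐ[ℚ] ℂ).symm : ℂ ≃ₐ[ℚ] ℂ) : ℂ →+* ℂ) (((σ : ℂ ≃ₐ[ℚ] ℂ) : ℂ →+* ℂ) c) = c :=
    fun σ c => (σ : ℂ ≃ₐ[ℚ] ℂ).symm_apply_apply c
  have hleft : ∀ (σ : E.fixingSubgroup) (v : ResGLnCohomology.CoeffModule ℂ n K lam),
      S₀' σ (S₀ σ v) = v :=
    fun σ v => ResGLnCohomology.coeffSemimap_leftInverse (hσσ' σ) (s σ) (s' σ) (hss' σ) v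
  -- `θ_σ = H^q(⊗_τ s_τ)` on `H^q(S_{K_f(𝔫)}, Ẽ_λ)`
  let θ : ∀ σ : E.fixingSubgroup,
      ResGLnCohomology.levelCohomology ℂ n K 𝔫 lam q →ₛₗ[((σ : ℂ ≃ₐ[ℚ] ℂ) : ℂ →+* ℂ)] ResGLnCohomology.levelCohomology ℂ n K 𝔫 lam q :=
    fun σ => TwistedQuotient.cohomologySemimap (ResGLnCohomology.diagPos n K) (ResGLnCohomology.level n K 𝔫)
      (ResGLnCohomology.coeffRepPos ℂ n K lam) (ResGLnCohomology.coeffRepPos ℂ n K lam) (S₀ σ) (hS₀ σ) q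
  have hθT : ∀ (σ : E.fixingSubgroup) (v : HeightOneSpectrum (𝓞 K)) (i : ℕ)
      (z : ResGLnCohomology.levelCohomology ℂ n K 𝔫 lam q),
      θ σ (ResGLnCohomology.heckeT ℂ n K 𝔫 lam q v i z) = ResGLnCohomology.heckeT ℂ n K 𝔫 lam q v i (θ σ z) :=
    fun σ v i z => TwistedQuotient.cohomologySemimap_heckeEnd (ResGLnCohomology.diagPos n K) (ResGLnCohomology.level n K 𝔫)
      (ResGLnCohomology.coeffRepPos ℂ n K lam) (ResGLnCohomology.coeffRepPos ℂ n K lam) (S₀ σ) (hS₀ σ)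
      (BigHeckeGLn.heckeElement n K v i) q z
  have hθinj : ∀ σ : E.fixingSubgroup, Function.Injective (θ σ) :=
    fun σ => TwistedQuotient.cohomologySemimap_injective_of_leftInverse (ResGLnCohomology.diagPos n K) (ResGLnCohomology.level n K 𝔫)
      (ResGLnCohomology.coeffRepPos ℂ n K lam) (ResGLnCohomology.coeffRepPos ℂ n K lam) (S₀ σ) (hS₀ σ) (S₀' σ) (hS₀' σ) (hleft σ) q
  -- the finite exceptional set `{v ∣ 𝔫}` and step (4)
  have hSfin : {v : HeightOneSpectrum (𝓞 K) | v.asIdeal ∣ 𝔫}.Finite := Ideal.finite_factors h𝔫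
  exact heckeEigenvalue_mem_subfield_cofinite_of_semilinearAction π.1 E hSfin
    (fun v i => ResGLnCohomology.heckeT ℂ n K 𝔫 lam q v i) θ hθT hθinj hx
    (fun v hv α hα i hi => heig v hv α hα i hi)


/-- **`Clozel1990_heckeEigenvalueField` from the realisation of cusp forms in the cohomology of
`Res_{K/ℚ} GL_n` and its finite-dimensionality** — the two remaining published inputs, as explicit
hypotheses on the tree's carrier `ResGLnCohomology.levelCohomology ℂ n K 𝔫 λ q =
H^q(GL_n(K)⁺, Fun(GL_n(𝔸_K^∞)/K_f(𝔫), ⊗_τ V_{λ_τ}(ℂ)))` with its `T_{v,i}`: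
`hE` = Clozel's Lemme 3.14–3.15 with Borel's injectivity of cuspidal into full cohomology and the
Satake eigenvalues of the `T_{v,i}` on the spherical vector; `hB` = Borel–Serre finiteness. The
`Aut(ℂ)`-symmetries of the coefficients are the theorem `GLnCohomology.exists_coeffSemimap`, and
everything else is `Clozel1990_heckeEigenvalueField_of_resRealisation_of_coeffSemimaps`.
[cite: Clozel1990, Thm. 3.13 (proof: Lemme 3.14–3.15 and §3.5, pp. 120–123)]
[cite: GrobnerRaghuram2014, §7.2–§7.3 and Thm. 50 (arXiv:1102.1872 numbering)] -/
theorem Clozel1990_heckeEigenvalueField_of_resRealisation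
    (hE : ∀ (n : ℕ) (K : Type) [Field K] [NumberField K]
      (hcpt : isCompact_glFiniteIntegralLevel n K) (π : CuspidalAutomorphicRepData n K hcpt),
      1 ≤ n → π.1.IsRegularAlgebraic →
      ∃ (𝔫 : Ideal (𝓞 K)) (_ : 𝔫 ≠ 0) (lam : (K →+* ℂ) → Fin n → ℤ) (q : ℕ)
        (x : ResGLnCohomology.levelCohomology ℂ n K 𝔫 lam q), x ≠ 0 ∧
        ∀ v : HeightOneSpectrum (𝓞 K), ¬ v.asIdeal ∣ 𝔫 → ∀ α : Multiset ℂ,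
          π.1.HasSatakeParamAt v α → ∀ i ≤ n,
            ResGLnCohomology.heckeT ℂ n K 𝔫 lam q v i x = heckeEigenvalueOf n v α i • x)
    (hB : ∀ (n : ℕ) (K : Type) [Field K] [NumberField K] (𝔫 : Ideal (𝓞 K)),
      𝔫 ≠ 0 → ∀ (lam : (K →+* ℂ) → Fin n → ℤ) (q : ℕ),
        FiniteDimensional ℂ (ResGLnCohomology.levelCohomology ℂ n K 𝔫 lam q)) :
    Clozel1990_heckeEigenvalueField :=
  Clozel1990_heckeEigenvalueField_of_resRealisation_of_coeffSemimaps
    (fun n σ μ => GLnCohomology.exists_coeffSemimap n σ μ) hE hB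

end Literature.NumberTheory.Automorphic

end
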